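import Mathlib

/-!
# `PachnerTwoThree` (cycle-free port): the pointwise 2–3 identity

CYCLE-FREE PORT (item stmt-KontsevichZagierPeriods-14098, route HyperbolicBloch) of
`Theorems/HyperbolicBlochPachnerTwoThreePointwise.lean` (stub `stub_exchangePointwise` of the crux
`HyperbolicBloch.PachnerTwoThree`, stmt-KontsevichZagierPeriods-3470, line `exchange-identity-symmdiff`).
The mathematics and the proofs are unchanged; only the import (`Mathlib` instead of the route's
Theses file, so that the gate can link the closure into `Theses/HyperbolicBloch.lean` without an
import cycle) and the namespace (`…PachnerTwoThreeFree`, fresh fully-qualified names) differ.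

For the crux's verbatim edge form `L u v p` (planar cross product, "left of `u → v`") and
circumsphere form `S u v w p` (the `4 × 4` insphere determinant expanded along its first row;
positive outside the hemisphere through `u, v, w` for a counter-clockwise triple) we prove:

* §1 the ring identities of the 2–3 move — spokes `A · L u q = β · L u v − γ · L w u`, radical planes
  (the EXCHANGE identity) `A · S u v q = γ · S u v w − S u v w(q̂) · L u v`, and the barycentric power
  identity `A · S u v w(q̂) = −(|v−w|² βγ + |w−u|² γα + |u−v|² αβ)`, where `q̂ = (Re q, Im q, 0)`,
  `(α, β, γ) = (L v w q̂, L w u q̂, L u v q̂)` are the barycentric weights of `q̂` and `A = α + β + γ`;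
* §2 `core` — the abstract sign-pattern lemma (pure linear/real arithmetic) — and the POINTWISE 2–3
  indicator identity `two_three_pointwise`: for `q̂` strictly inside the ccw triangle `(u, v, w)` and
  `p` off the scaffold `{S u v w = 0} ∪ {L u q = 0} ∪ {L v q = 0} ∪ {L w q = 0}`,
  `p ∈ prism(u,v,w) ∪ inner(q;u,v,w) ↔ p ∈ prism(u,v,q) ∪ prism(v,w,q) ∪ prism(w,u,q)`
  (typed membership conditions of the crux, verbatim).

The two unions are NOT equal as sets (cevian walls; `Theorems/PachnerTwoThree/Negative/ExactUnion`),
so the scaffold is genuinely needed; it is Lebesgue-null (companion file `…FreeScaffold`).  Originally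
adapted from the standing disprover's kernel-checked `Cruxes/PachnerTwoThree/Disproof.lean` §§1–2
(refuter-cdisprove, 2026-08-15).

References: J. Dupont, C.-H. Sah, *Scissors congruences II* (1982) (5.3) (the 2–3 move = five-term
relation); W. Neumann, *Hilbert's 3rd problem and invariants of 3-manifolds* (1998) §2;
M. Kontsevich, D. Zagier, *Periods* (2001) §1.2 rule (1a).
-/

noncomputable section

namespace Summit.KontsevichZagierPeriods.HyperbolicBloch.PachnerTwoThreeFree

/-! ## §0 Coordinates of the boundary point `q̂ = ![Re q, Im q, 0]` -/

/-- `![a, b, c] 0 = a`. -/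
theorem vec3_zero (a b c : ℝ) : (![a, b, c] : Fin 3 → ℝ) 0 = a := rfl

/-- `![a, b, c] 1 = b`. -/
theorem vec3_one (a b c : ℝ) : (![a, b, c] : Fin 3 → ℝ) 1 = b := rfl

/-- `![a, b, c] 2 = c`. -/
theorem vec3_two (a b c : ℝ) : (![a, b, c] : Fin 3 → ℝ) 2 = c := rfl

/-! ## §1 Identities -/
section Identities

variable {L : ℂ → ℂ → (Fin 3 → ℝ) → ℝ} {S : ℂ → ℂ → ℂ → (Fin 3 → ℝ) → ℝ}

variable (hL : ∀ u v p, L u v p = (v.re - u.re) * (p 1 - u.im) - (v.im - u.im) * (p 0 - u.re))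
  (hS : ∀ u v w p, S u v w p = (p 0 ^ 2 + p 1 ^ 2 + p 2 ^ 2) * (u.re * (v.im - w.im) - u.im * (v.re - w.re) + (v.re * w.im - v.im * w.re)) - p 0 * (Complex.normSq u * (v.im - w.im) - u.im * (Complex.normSq v - Complex.normSq w) + (Complex.normSq v * w.im - v.im * Complex.normSq w)) + p 1 * (Complex.normSq u * (v.re - w.re) - u.re * (Complex.normSq v - Complex.normSq w) + (Complex.normSq v * w.re - v.re * Complex.normSq w)) - (Complex.normSq u * (v.re * w.im - v.im * w.re) - u.re * (Complex.normSq v * w.im - v.im * Complex.normSq w) + u.im * (Complex.normSq v * w.re - v.re * Complex.normSq w)))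
include hL

/-- `L` is antisymmetric in its two vertices. -/
theorem L_anti (u v : ℂ) (p : Fin 3 → ℝ) : L v u p = -L u v p := by simp only [hL]; ring

/-- Spoke identity through `u`: `A · L u q = β · L u v − γ · L w u`, `A = α + β + γ` the double area,
`(α, β, γ) = (L v w q̂, L w u q̂, L u v q̂)` the barycentric coordinates of `q̂`. -/
theorem spoke_uq (u v w q : ℂ) (p : Fin 3 → ℝ) :
    (L u v ![q.re, q.im, 0] + L v w ![q.re, q.im, 0] + L w u ![q.re, q.im, 0]) * L u q p
      = L w u ![q.re, q.im, 0] * L u v p - L u v ![q.re, q.im, 0] * L w u p := by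
  simp only [hL, vec3_zero, vec3_one]; ring

/-- Spoke identity, reversed spoke `q → u`. -/
theorem spoke_qu (u v w q : ℂ) (p : Fin 3 → ℝ) :
    (L u v ![q.re, q.im, 0] + L v w ![q.re, q.im, 0] + L w u ![q.re, q.im, 0]) * L q u p
      = L u v ![q.re, q.im, 0] * L w u p - L w u ![q.re, q.im, 0] * L u v p := by
  simp only [hL, vec3_zero, vec3_one]; ring

/-- Spoke identity through `v`. -/
theorem spoke_vq (u v w q : ℂ) (p : Fin 3 → ℝ) :
    (L u v ![q.re, q.im, 0] + L v w ![q.re, q.im, 0] + L w u ![q.re, q.im, 0]) * L v q p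
      = L u v ![q.re, q.im, 0] * L v w p - L v w ![q.re, q.im, 0] * L u v p := by
  simp only [hL, vec3_zero, vec3_one]; ring

/-- Spoke identity, reversed spoke `q → v`. -/
theorem spoke_qv (u v w q : ℂ) (p : Fin 3 → ℝ) :
    (L u v ![q.re, q.im, 0] + L v w ![q.re, q.im, 0] + L w u ![q.re, q.im, 0]) * L q v p
      = L v w ![q.re, q.im, 0] * L u v p - L u v ![q.re, q.im, 0] * L v w p := by
  simp only [hL, vec3_zero, vec3_one]; ring

/-- Spoke identity through `w`. -/
theorem spoke_wq (u v w q : ℂ) (p : Fin 3 → ℝ) :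
    (L u v ![q.re, q.im, 0] + L v w ![q.re, q.im, 0] + L w u ![q.re, q.im, 0]) * L w q p
      = L v w ![q.re, q.im, 0] * L w u p - L w u ![q.re, q.im, 0] * L v w p := by
  simp only [hL, vec3_zero, vec3_one]; ring

/-- Spoke identity, reversed spoke `q → w`. -/
theorem spoke_qw (u v w q : ℂ) (p : Fin 3 → ℝ) :
    (L u v ![q.re, q.im, 0] + L v w ![q.re, q.im, 0] + L w u ![q.re, q.im, 0]) * L q w p
      = L w u ![q.re, q.im, 0] * L v w p - L v w ![q.re, q.im, 0] * L w u p := by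
  simp only [hL, vec3_zero, vec3_one]; ring

/-- The spoke through `u` evaluated at the far vertex `w` is the barycentric weight `β`. -/
theorem L_uq_hat_w (u w q : ℂ) : L u q ![w.re, w.im, 0] = L w u ![q.re, q.im, 0] := by
  simp only [hL, vec3_zero, vec3_one]; ring

/-- The spoke through `v` evaluated at `u` is the barycentric weight `γ`. -/
theorem L_vq_hat_u (u v q : ℂ) : L v q ![u.re, u.im, 0] = L u v ![q.re, q.im, 0] := by
  simp only [hL, vec3_zero, vec3_one]; ring

/-- The spoke through `w` evaluated at `v` is the barycentric weight `α`. -/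
theorem L_wq_hat_v (v w q : ℂ) : L w q ![v.re, v.im, 0] = L v w ![q.re, q.im, 0] := by
  simp only [hL, vec3_zero, vec3_one]; ring

include hS

/-- Radical-plane (exchange) identity for the edge `uv`:
`A · S u v q = γ · S u v w + K · L u v` with `K = −S u v w q̂`. -/
theorem sphere_uvq (u v w q : ℂ) (p : Fin 3 → ℝ) :
    (L u v ![q.re, q.im, 0] + L v w ![q.re, q.im, 0] + L w u ![q.re, q.im, 0]) * S u v q p
      = L u v ![q.re, q.im, 0] * S u v w p + (-S u v w ![q.re, q.im, 0]) * L u v p := by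
  simp only [hL, hS, vec3_zero, vec3_one, vec3_two, Complex.normSq_apply]; ring

/-- Radical-plane (exchange) identity for the edge `vw`. -/
theorem sphere_vwq (u v w q : ℂ) (p : Fin 3 → ℝ) :
    (L u v ![q.re, q.im, 0] + L v w ![q.re, q.im, 0] + L w u ![q.re, q.im, 0]) * S v w q p
      = L v w ![q.re, q.im, 0] * S u v w p + (-S u v w ![q.re, q.im, 0]) * L v w p := by
  simp only [hL, hS, vec3_zero, vec3_one, vec3_two, Complex.normSq_apply]; ring

/-- Radical-plane (exchange) identity for the edge `wu`. -/
theorem sphere_wuq (u v w q : ℂ) (p : Fin 3 → ℝ) :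
    (L u v ![q.re, q.im, 0] + L v w ![q.re, q.im, 0] + L w u ![q.re, q.im, 0]) * S w u q p
      = L w u ![q.re, q.im, 0] * S u v w p + (-S u v w ![q.re, q.im, 0]) * L w u p := by
  simp only [hL, hS, vec3_zero, vec3_one, vec3_two, Complex.normSq_apply]; ring

/-- Barycentric power identity: `A · S u v w q̂ = −(|v−w|² βγ + |w−u|² γα + |u−v|² αβ)`. -/
theorem power_hat (u v w q : ℂ) :
    (L u v ![q.re, q.im, 0] + L v w ![q.re, q.im, 0] + L w u ![q.re, q.im, 0]) * S u v w ![q.re, q.im, 0]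
      = -(((v.re - w.re) ^ 2 + (v.im - w.im) ^ 2) * L w u ![q.re, q.im, 0] * L u v ![q.re, q.im, 0]
        + ((w.re - u.re) ^ 2 + (w.im - u.im) ^ 2) * L u v ![q.re, q.im, 0] * L v w ![q.re, q.im, 0]
        + ((u.re - v.re) ^ 2 + (u.im - v.im) ^ 2) * L v w ![q.re, q.im, 0] * L w u ![q.re, q.im, 0]) := by
  simp only [hL, hS, vec3_zero, vec3_one, vec3_two, Complex.normSq_apply]; ring

end Identities

/-! ## §2 The pointwise 2–3 identity -/
section Pointwise

/-- **Abstract core of the 2–3 move** (pure real inequalities).  `α β γ > 0` are the barycentric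
weights of the inner point, `K > 0` minus its power, `a b c` the edge forms of the moving point,
`σ` its big-sphere value; the nine remaining reals are the spoke and small-sphere values, tied to
the former by the §1 identities (hypotheses `e…`).  Off `σ = 0` and the three spokes the two sides
of the 2–3 move contain the same points. -/
theorem core {α β γ K A a b c σ Luq Lqu Lvq Lqv Lwq Lqw Suvq Svwq Swuq : ℝ}
    (hα : 0 < α) (hβ : 0 < β) (hγ : 0 < γ) (hK : 0 < K) (hA : 0 < A)
    (euq : A * Luq = β * c - γ * b) (equ : A * Lqu = γ * b - β * c)
    (evq : A * Lvq = γ * a - α * c) (eqv : A * Lqv = α * c - γ * a)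
    (ewq : A * Lwq = α * b - β * a) (eqw : A * Lqw = β * a - α * b)
    (e₁ : A * Suvq = γ * σ + K * c) (e₂ : A * Svwq = α * σ + K * a)
    (e₃ : A * Swuq = β * σ + K * b)
    (hσ : σ ≠ 0) (hu : Luq ≠ 0) (hv : Lvq ≠ 0) (hw : Lwq ≠ 0) :
    ((0 < c ∧ 0 < a ∧ 0 < b ∧ 0 < σ) ∨ (σ < 0 ∧ 0 < Suvq ∧ 0 < Svwq ∧ 0 < Swuq)) ↔
    ((0 < c ∧ 0 < Lvq ∧ 0 < Lqu ∧ 0 < Suvq) ∨ (0 < a ∧ 0 < Lwq ∧ 0 < Lqv ∧ 0 < Svwq) ∨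
      (0 < b ∧ 0 < Luq ∧ 0 < Lqw ∧ 0 < Swuq)) := by
  have t : ∀ {X Y : ℝ}, A * X = Y → (0 < X ↔ 0 < Y) := fun e => by
    rw [← e, mul_pos_iff_of_pos_left hA]
  have h₁ : β * c - γ * b ≠ 0 := by rw [← euq]; exact mul_ne_zero hA.ne' hu
  have h₂ : γ * a - α * c ≠ 0 := by rw [← evq]; exact mul_ne_zero hA.ne' hv
  have h₃ : α * b - β * a ≠ 0 := by rw [← ewq]; exact mul_ne_zero hA.ne' hw
  rw [t euq, t equ, t evq, t eqv, t ewq, t eqw, t e₁, t e₂, t e₃]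
  have lin : α * (β * c - γ * b) + β * (γ * a - α * c) + γ * (α * b - β * a) = 0 := by ring
  constructor
  · intro h
    have key : 0 < a ∧ 0 < b ∧ 0 < c ∧ 0 < γ * σ + K * c ∧ 0 < α * σ + K * a ∧
        0 < β * σ + K * b := by
      rcases h with ⟨hc, ha, hb, hs⟩ | ⟨hs, k1, k2, k3⟩
      · exact ⟨ha, hb, hc, by positivity, by positivity, by positivity⟩
      · have hγσ : γ * σ < 0 := mul_neg_of_pos_of_neg hγ hs
        have hασ : α * σ < 0 := mul_neg_of_pos_of_neg hα hs
        have hβσ : β * σ < 0 := mul_neg_of_pos_of_neg hβ hs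
        exact ⟨pos_of_mul_pos_right (by linarith) hK.le, pos_of_mul_pos_right (by linarith) hK.le,
          pos_of_mul_pos_right (by linarith) hK.le, k1, k2, k3⟩
    obtain ⟨ha, hb, hc, hs1, hs2, hs3⟩ := key
    rcases lt_or_gt_of_ne h₁ with k₁ | k₁ <;> rcases lt_or_gt_of_ne h₂ with k₂ | k₂ <;>
      rcases lt_or_gt_of_ne h₃ with k₃ | k₃
    · exfalso
      have := mul_neg_of_pos_of_neg hα k₁
      have := mul_neg_of_pos_of_neg hβ k₂
      have := mul_neg_of_pos_of_neg hγ k₃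
      linarith
    · exact Or.inr (Or.inl ⟨ha, k₃, by linarith, hs2⟩)
    · exact Or.inl ⟨hc, k₂, by linarith, hs1⟩
    · exact Or.inl ⟨hc, k₂, by linarith, hs1⟩
    · exact Or.inr (Or.inr ⟨hb, k₁, by linarith, hs3⟩)
    · exact Or.inr (Or.inl ⟨ha, k₃, by linarith, hs2⟩)
    · exact Or.inr (Or.inr ⟨hb, k₁, by linarith, hs3⟩)
    · exfalso
      have := mul_pos hα k₁
      have := mul_pos hβ k₂
      have := mul_pos hγ k₃
      linarith
  · intro h
    rcases h with ⟨hc, h2, h1, hs⟩ | ⟨ha, h3, h2, hs⟩ | ⟨hb, h1, h3, hs⟩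
    · have ha : 0 < a := by
        have : 0 < γ * a := by nlinarith [mul_pos hα hc]
        exact pos_of_mul_pos_right this hγ.le
      have hb : 0 < b := by
        have : 0 < γ * b := by nlinarith [mul_pos hβ hc]
        exact pos_of_mul_pos_right this hγ.le
      rcases lt_or_gt_of_ne hσ with k | k
      · refine Or.inr ⟨k, hs, ?_, ?_⟩
        · have e : γ * (α * σ + K * a) = α * (γ * σ + K * c) + K * (γ * a - α * c) := by ring
          have : 0 < γ * (α * σ + K * a) := by rw [e]; positivity
          exact pos_of_mul_pos_right this hγ.le
        · have e : γ * (β * σ + K * b) = β * (γ * σ + K * c) + K * (γ * b - β * c) := by ring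
          have : 0 < γ * (β * σ + K * b) := by rw [e]; positivity
          exact pos_of_mul_pos_right this hγ.le
      · exact Or.inl ⟨hc, ha, hb, k⟩
    · have hb : 0 < b := by
        have : 0 < α * b := by nlinarith [mul_pos hβ ha]
        exact pos_of_mul_pos_right this hα.le
      have hc : 0 < c := by
        have : 0 < α * c := by nlinarith [mul_pos hγ ha]
        exact pos_of_mul_pos_right this hα.le
      rcases lt_or_gt_of_ne hσ with k | k
      · refine Or.inr ⟨k, ?_, hs, ?_⟩
        · have e : α * (γ * σ + K * c) = γ * (α * σ + K * a) + K * (α * c - γ * a) := by ring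
          have : 0 < α * (γ * σ + K * c) := by rw [e]; positivity
          exact pos_of_mul_pos_right this hα.le
        · have e : α * (β * σ + K * b) = β * (α * σ + K * a) + K * (α * b - β * a) := by ring
          have : 0 < α * (β * σ + K * b) := by rw [e]; positivity
          exact pos_of_mul_pos_right this hα.le
      · exact Or.inl ⟨hc, ha, hb, k⟩
    · have hc : 0 < c := by
        have : 0 < β * c := by nlinarith [mul_pos hγ hb]
        exact pos_of_mul_pos_right this hβ.le
      have ha : 0 < a := by
        have : 0 < β * a := by nlinarith [mul_pos hα hb]
        exact pos_of_mul_pos_right this hβ.le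
      rcases lt_or_gt_of_ne hσ with k | k
      · refine Or.inr ⟨k, ?_, ?_, hs⟩
        · have e : β * (γ * σ + K * c) = γ * (β * σ + K * b) + K * (β * c - γ * b) := by ring
          have : 0 < β * (γ * σ + K * c) := by rw [e]; positivity
          exact pos_of_mul_pos_right this hβ.le
        · have e : β * (α * σ + K * a) = α * (β * σ + K * b) + K * (β * a - α * b) := by ring
          have : 0 < β * (α * σ + K * a) := by rw [e]; positivity
          exact pos_of_mul_pos_right this hβ.le
      · exact Or.inl ⟨hc, ha, hb, k⟩

variable {L : ℂ → ℂ → (Fin 3 → ℝ) → ℝ} {S : ℂ → ℂ → ℂ → (Fin 3 → ℝ) → ℝ}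

variable (hL : ∀ u v p, L u v p = (v.re - u.re) * (p 1 - u.im) - (v.im - u.im) * (p 0 - u.re))
  (hS : ∀ u v w p, S u v w p = (p 0 ^ 2 + p 1 ^ 2 + p 2 ^ 2) * (u.re * (v.im - w.im) - u.im * (v.re - w.re) + (v.re * w.im - v.im * w.re)) - p 0 * (Complex.normSq u * (v.im - w.im) - u.im * (Complex.normSq v - Complex.normSq w) + (Complex.normSq v * w.im - v.im * Complex.normSq w)) + p 1 * (Complex.normSq u * (v.re - w.re) - u.re * (Complex.normSq v - Complex.normSq w) + (Complex.normSq v * w.re - v.re * Complex.normSq w)) - (Complex.normSq u * (v.re * w.im - v.im * w.re) - u.re * (Complex.normSq v * w.im - v.im * Complex.normSq w) + u.im * (Complex.normSq v * w.re - v.re * Complex.normSq w)))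
include hL

/-- If `q̂` is strictly left of `u → v` then `u ≠ v` (as points of the plane). -/
theorem dist_sq_pos_of_inside {u v q : ℂ} (h1 : 0 < L u v ![q.re, q.im, 0]) :
    0 < (u.re - v.re) ^ 2 + (u.im - v.im) ^ 2 := by
  by_contra hle
  push Not at hle
  have e1 : u.re - v.re = 0 := by nlinarith [sq_nonneg (u.re - v.re), sq_nonneg (u.im - v.im)]
  have e2 : u.im - v.im = 0 := by nlinarith [sq_nonneg (u.re - v.re), sq_nonneg (u.im - v.im)]
  have : L u v ![q.re, q.im, 0] = 0 := by
    rw [hL]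
    have h1' : v.re = u.re := by linarith
    have h2' : v.im = u.im := by linarith
    rw [h1', h2']; ring
  linarith

include hS

/-- The inner point lies strictly inside the circumcircle: `S u v w q̂ < 0` (so `K = −S u v w q̂ > 0`;
Delaunay / empty-circle property of an interior point). -/
theorem S_hat_neg {u v w q : ℂ} (h1 : 0 < L u v ![q.re, q.im, 0]) (h2 : 0 < L v w ![q.re, q.im, 0])
    (h3 : 0 < L w u ![q.re, q.im, 0]) : S u v w ![q.re, q.im, 0] < 0 := by
  have hA : 0 < L u v ![q.re, q.im, 0] + L v w ![q.re, q.im, 0] + L w u ![q.re, q.im, 0] := by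
    linarith
  have huv := dist_sq_pos_of_inside hL h1
  have hE : 0 < ((v.re - w.re) ^ 2 + (v.im - w.im) ^ 2) * L w u ![q.re, q.im, 0] * L u v ![q.re, q.im, 0]
        + ((w.re - u.re) ^ 2 + (w.im - u.im) ^ 2) * L u v ![q.re, q.im, 0] * L v w ![q.re, q.im, 0]
        + ((u.re - v.re) ^ 2 + (u.im - v.im) ^ 2) * L v w ![q.re, q.im, 0] * L w u ![q.re, q.im, 0] := by
    have t1 : 0 ≤ ((v.re - w.re) ^ 2 + (v.im - w.im) ^ 2) * L w u ![q.re, q.im, 0]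
        * L u v ![q.re, q.im, 0] := by positivity
    have t2 : 0 ≤ ((w.re - u.re) ^ 2 + (w.im - u.im) ^ 2) * L u v ![q.re, q.im, 0]
        * L v w ![q.re, q.im, 0] := by positivity
    have t3 : 0 < ((u.re - v.re) ^ 2 + (u.im - v.im) ^ 2) * L v w ![q.re, q.im, 0]
        * L w u ![q.re, q.im, 0] := by positivity
    linarith
  have hp := power_hat hL hS u v w q
  have : (L u v ![q.re, q.im, 0] + L v w ![q.re, q.im, 0] + L w u ![q.re, q.im, 0])
      * S u v w ![q.re, q.im, 0] < 0 := by linarith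
  exact lt_of_mul_lt_mul_left (b := S u v w ![q.re, q.im, 0]) (c := 0) (by simpa using this) hA.le

/-- **The pointwise 2–3 identity.**  For `q̂` strictly inside the counter-clockwise triangle
`(u, v, w)` and a point `p` off the scaffold `S u v w p · L u q p · L v q p · L w q p = 0`:
`p ∈ prism(u,v,w) ∪ inner ⇔ p ∈ prism(u,v,q) ∪ prism(v,w,q) ∪ prism(w,u,q)` (typed membership
conditions, verbatim). -/
theorem two_three_pointwise {u v w q : ℂ} (h1 : 0 < L u v ![q.re, q.im, 0])
    (h2 : 0 < L v w ![q.re, q.im, 0]) (h3 : 0 < L w u ![q.re, q.im, 0]) {p : Fin 3 → ℝ}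
    (hσ : S u v w p ≠ 0) (hu : L u q p ≠ 0) (hv : L v q p ≠ 0) (hw : L w q p ≠ 0) :
    ((0 < p 2 ∧ 0 < L u v p ∧ 0 < L v w p ∧ 0 < L w u p ∧ 0 < S u v w p) ∨
      (0 < p 2 ∧ S u v w p < 0 ∧ 0 < S u v q p ∧ 0 < S v w q p ∧ 0 < S w u q p)) ↔
    ((0 < p 2 ∧ 0 < L u v p ∧ 0 < L v q p ∧ 0 < L q u p ∧ 0 < S u v q p) ∨
      (0 < p 2 ∧ 0 < L v w p ∧ 0 < L w q p ∧ 0 < L q v p ∧ 0 < S v w q p) ∨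
      (0 < p 2 ∧ 0 < L w u p ∧ 0 < L u q p ∧ 0 < L q w p ∧ 0 < S w u q p)) := by
  by_cases ht : 0 < p 2
  · simp only [ht, true_and]
    have hA : 0 < L u v ![q.re, q.im, 0] + L v w ![q.re, q.im, 0] + L w u ![q.re, q.im, 0] := by
      linarith
    have hK : 0 < -S u v w ![q.re, q.im, 0] := by linarith [S_hat_neg hL hS h1 h2 h3]
    exact core h2 h3 h1 hK hA (spoke_uq hL u v w q p) (spoke_qu hL u v w q p)
      (spoke_vq hL u v w q p) (spoke_qv hL u v w q p) (spoke_wq hL u v w q p)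
      (spoke_qw hL u v w q p) (sphere_uvq hL hS u v w q p) (sphere_vwq hL hS u v w q p)
      (sphere_wuq hL hS u v w q p) hσ hu hv hw
  · simp only [ht, false_and, or_self]

end Pointwise

end Summit.KontsevichZagierPeriods.HyperbolicBloch.PachnerTwoThreeFree

end
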